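import Summits.QuantumFields.YangMills.Theses.ParabolicTrajectory
import Summits.QuantumFields.YangMills.Theorems.TunedSequenceExists.Negative.Glue
import Literature.MathematicalPhysics.QuantumFieldTheory.BlockScaleEffectivePerturbation

/-!
# Line `transport-to-fixed-distance` — skeleton for the crux `ParabolicTrajectory.TunedSequenceExists`

(crux item stmt-QuantumFields-10524 = (S) of route `ParabolicTrajectory`; idea card
`Cruxes/TunedSequenceExists/Ideas/transport-to-fixed-distance.md`, triage r1-1/r1-2/r1-3: pass;
planner crux-plan seat, round 1. Line card: `Lines/transport-to-fixed-distance.md`.)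

THE LINE. The crux asks, for every compact simple `G`, faithful unitary `r` and `M ≥ 2`, for tuned
`M`-adic Wilson sequences (`a_k = M^{-n_k}`, `β_k → ∞`) realising every small value `θ` of the
rescaled curvature two-point function `N_1 = D⁸ ⟨P ; τ_D P⟩`, `D = M^{n_k}`, with all `N_t`
convergent. By the standing Disproof (§ Glue, § ClauseThree) this is EXACTLY (a finite-volume
correlator window LOWER bound: `N_1 ≥ θ₀` somewhere beyond every coupling, at arbitrarily fine depth
and in arbitrarily large volume) + (an a-priori bound on the `N_t` along the witness) + elementary
glue (β-continuity, freezing, IVT, diagonal extraction). The idea produces BOTH analytic inputs from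
one mechanism: factor the separation `D = K'·L'` with `K' = M^{j₀}` FIXED and `L' = M^{m-j₀} → ∞`;
block the fine Wilson theory by `L'` (Bałaban's density flow, `L'`-fold gauge-covariant averaging)
onto a Bałaban-format effective theory `𝓔` at FIXED weak effective coupling `𝓔.β ≍ 1/u` (`u = g*²`,
the squared running coupling at scale `L'`, pinned by placing the bare coupling at its
asymptotic-freedom value — that is what "tuned" means); transport the block-averaged fine action
density down the flow by a ONE-insertion LINEAR statement `E[P̄₀ | V] = c - L'⁻⁴ Φ(V) + Rem` with a
plaquette-like coarse observable `Φ` and an all-`V` cap; then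
`N_t = K'⁸ · Cov_𝓔(Φ₀, Φ_{tK'}) ± K'⁸ (C' u³ + Cfl u² e^{-cfl K'}) ± η` (law of total covariance; the
fluctuation covariance across the coarse distance `K'` is exponentially small and `∝ u²`): the
covariance is PRODUCED at the fixed coarse separation `K'`, in a theory with finitely many scales,
where the two-gluon exchange gives `K'⁸ Cov ≥ c₁/𝓔.β² ≍ c₁ u²` (the fixed window, plain Wilson),
robustly under the format terms (relative `o(1)`). Two-sidedness of the identity at every `β ≥ β*` and
every `t` gives the a-priori bound from the TRIVIAL coarse bound `|Cov_𝓔| ≤ 2 BΦ²` — no reflection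
positivity anywhere.

STUBS (registered; the only `sorry`s of the file):
* `stub_transport : TwoSidedTransport` — HARDEST (XL, the lever): the ∃-package — format data and
  class constants UNIFORM in `u`; coupling window `cβ/u ≤ 𝓔.β` (and `≤ Cβ/u` at `β*`); exact
  push-forward of Wilson's measure onto the Gibbs measure of `𝓔`; plaquette-like `Φ`; the two-sided
  identity at all `t` and all `β ≥ β*`. Internally (line card § Stubs, the foreseen split): T1 density
  flow in format (Bałaban CMP 119 Thm 1/2 for general compact `G`, unvendored), T2 one-insertion
  transport with the all-`V` cap (TRIAGE S3), T3 conditional (fluctuation) covariance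
  `≤ Cfl u² e^{-cfl K'} L'⁻⁸` (the "screen" shared with `block-conditioned-covariance`), T4 total
  covariance.
* `stub_fixedWindowWilson : FixedWindowLowerBound` — (L) the plain-Wilson `Φ–Φ` covariance at FIXED
  lattice distance `K'` is `≥ c₁(G, r) β⁻² K'⁻⁸` for `β ≥ β₀(CΦ, BΦ, K')`, uniformly over the class
  (`z ∈ [1/2,2]`, `R < K'/2`) and the volume `S ≥ Cvol K'` (TRIAGE r1-2's recommended common first
  stub of both covariance lines).
* `stub_formatRobustness : FormatRobustness` — (M) in-format terms (size `B₀ ≤ Λ rad²` on domains of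
  radius `rad`, threshold `ε`, with `β ε, β rad² ≥ P₀`) move `K'⁸ Cov` by `≤ δ β⁻²` for any `δ > 0`
  beyond thresholds `P₀(δ, K', …), β₁(δ, K', …)` — scale-covariant, so that Bałaban's `g`-dependent
  domains (`rad ≍ g p₀(g)`, `β ε = p₀²`) are admissible (card falsifier (2) defused).

COMPOSITION (proved, § Glue B): `Glue.lowerBoundApriori_of_stubs` — the window placement: choose
`K' = M^{j₀}` with `Cfl K'⁸ e^{-cfl K'} ≤ c₁/(8 Cβ'²)` (possible BEFORE `u` is fixed because the
fluctuation error carries `u²` — the one quantitative feature of `stub_transport` the assembly leans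
on), then the thresholds `β₀(K')` and `P₀, β₁` (robustness at `δ = c₁/4`), then `u ≤ u₀(P₀)` below
every threshold (`cβ/u ≥ β₀, β₁`; `C' K'⁸ u ≤ c₁/(8Cβ'²)`), then `η = θ₀ = c₁ u²/(8 Cβ'²)`;
`Glue.window_of_lowerBoundApriori` — IVT tuning above `β*_k` at every stage (imported
`Negative.Glue.exists_ge_corr_eq`: β-continuity + freezing), scheme assembly `a_k = M^{-m_k}`,
`β_k ≥ β*_k ≥ k`, `L_k ≥ (k+1) M^{m_k}`, the a-priori bound ⇒ `WindowBdd` ⇒ `Window` (copied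
diagonal extraction `Glue.window_of_windowBdd`); `TunedSequenceExists_of` concludes the crux BY NAME
from the `Registered.stub_*` aliases (`Glue.tunedSequenceExists_iff` is `Iff.rfl`).

DISPROOF USED (`Cruxes/TunedSequenceExists/Disproof.lean`, gen 3, re-read 2026-08-16). § Targets is
EMPTY — no `_false_without_` theorem constrains any line; the load-bearing kills (`M ∈ {0, 1}`,
trivial `G`, unfaithful `ρ`, `β ≡ 0`, dominating `β`) are honoured: every stub carries
`IsCompactSimpleLieGroup G`, a faithful `r`, `2 ≤ M`, and `β*` is a TUNED divergence (AF placement,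
below § Ceiling's `b(n, L)`, above any `B`; `stub_transport` is where it is used). § Glue,
§ ClauseThree, § Freezing are CONSUMED (copied `Window`, `window_of_windowBdd`; imported
`Negative.Glue`, `Negative.Freezing`): the stubs output exactly `CorrelatorWindowLowerBound` + an
a-priori bound ALONG THE WITNESS (`Glue.LowerBoundApriori`), in the quantifier order of warning (2)
(`∀ B, … ∃ β* ≥ B`), and discharge clause (iii) WITHOUT `CorrMonotoneNonneg` (warning (1): odd tori,
no RP in the tree) and without the `β = 0` endpoint (§ BetaZero unused). § Madic: `K' = M^{j₀}` is a
legal coarse separation (`window_of_window_pow` not needed). § Exponent: the canonical power 8 with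
`θ₀ ≍ u²` (the strong form). § Clustering (calibration, not a defect): the three stubs imply
`¬ UniformClustering r` for every admissible `(G, r)` — `stub_transport ∧ stub_fixedWindowWilson`
is at least a non-uniform-clustering theorem for 4-d `SU(N)`, as the card concedes. Landed Negative
lemmas (`Theorems/TunedSequenceExists/Negative/*`, importable; `Negative.Glue`/`Freezing`/
`AtZeroFalse` ARE imported): `FiniteGroupFalse`/`FiniteAbelianClustering` refute the
`Nontrivial`-weakening for finite abelian `G` — no stub is an instance (all are over compact SIMPLE
`G`; for a finite `G` the transport's window `cβ/u ≤ 𝓔.β`, `u → 0`, is where discreteness would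
bite); `UnfaithfulFalse`, `TwoLeMFalse`, `AtZeroFalse`, `DominatingFalse`, `UniformClustering`,
`Exponent` as above.

TRIAGE ANSWERS (r1-1 S1–S3 and §D, r1-2, r1-3): S1 — quantifier shape `∀ B m₀ L₀, ∃ m L, ∃ β* ≥ B`
(no mis-scaled floor `n ≤ β`); S2 — the blocking is EXISTENTIAL (`∃ link`, measurable; intended
inhabitant the iterated Bałaban averaging `BalabanAveraging.link`, which works on ANY torus side with
a ragged seam — this also answers the even-`M`/odd-torus objection: fine side `2L+1`, coarse side
`Sc` free) and the coupling window excludes decimation in substance; S3 — the registered statement is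
at COVARIANCE level (two-sided identity), the all-`V` cap being part of T2 inside `stub_transport`
(without it the identity is false, r1-1 §D / r1-3 (1)); support radius vs `K'` (r1-2, r1-3 (3)) —
`R` is per instance with `2R < K'`, and `β₀`, `β₁` are uniform only over `R < K'/2` at fixed `K'`;
z = ∏(1+O(g⁴)) (r1-3) — `z ∈ [1/2, 2]` per instance, thresholds uniform in `z`; small coarse tori /
torons (r1-2) — `S ≥ Cvol K'` in the fixed window, `S > 2K'` in robustness, and the LOWER bound is
mixture-robust.
-/

noncomputable section

open Filter Topology MeasureTheory
open scoped Matrix.Norms.Frobenius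
open Literature.MathematicalPhysics.QuantumFieldTheory Literature.MathematicalPhysics.QuantumLattice
open Summit.QuantumFields.YangMills.Theses.ParabolicTrajectory (TunedSequenceExists)
open Summit.QuantumFields.YangMills.Theorems.TunedSequenceExists.Negative.Glue (exists_ge_corr_eq)

namespace Summit.QuantumFields.YangMills.Cruxes.TunedSequenceExists.TransportToFixedDistance

/-! ## § Notation — the crux's rescaled correlator at lattice data -/

section Notation

variable {G : Type} [Group G] [TopologicalSpace G] [IsTopologicalGroup G] [CompactSpace G]
  [MeasurableSpace G] [BorelSpace G]

/-- `N_t(β; m, L) := (M^m)^8 · ⟨P ; τ_{t M^m} P⟩_{β, 2L+1}` — the crux's rescaled connected curvature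
two-point function at lattice depth `m` (separation unit `D = M^m`), torus half-side `L`, inverse
coupling `β`, integer physical separation `t` (`P = r.curvature.F = actionDensity r.ρ`). -/
def rescaledCorr (r : LatticeRep G) (M m L : ℕ) (β : ℝ) (t : ℕ) : ℝ :=
  ((M : ℝ) ^ m) ^ 8 * latticeConnectedCorr r.ρ β (2 * L + 1) r.curvature.F r.curvature.F (t * M ^ m)

end Notation

/-! ## § Class — plaquette-like coarse observables -/

section Class

variable {G : Type} [Group G] [MeasurableSpace G] {N : ℕ}

/-- The deficit `N - Re tr ρ(U_p) ≥ 0` of the `ℤ⁴` plaquette `p` (quadratic order in the field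
strength). -/
def deficit (ρ : G →* Matrix (Fin N) (Fin N) ℂ) (p : ZdPlaquette 4) (U : LGConfig 4 G) : ℝ :=
  (N : ℝ) - plaquetteObs ρ p.1 p.2.1.1 p.2.1.2 U

/-- **Plaquette-like coarse observables** with constants `(z, CΦ, BΦ, R)`: `Φ` is a bounded
(`|Φ| ≤ BΦ`), measurable, gauge-invariant function of the holonomies of finitely many plaquettes `Pl`
within sup-distance `R` of the origin, through a `C³` function `F` of the representing matrices with
`‖D³F‖ ≤ CΦ` (smoothness near flat configurations is what makes the fixed-window bound UNIFORM over
the class: `Φ = Q_Φ + O(|F|³)` with a positive semi-definite quadratic part), of quadratic GROWTH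
`Φ ≤ CΦ · ∑_{p ∈ Pl} deficit_p`, and DOMINATING `z` times the origin action-density deficit up to a
cubic-order error, `Φ ≥ z · (6N - actionDensity) - CΦ · (∑_{p ∈ Pl} deficit_p)^{3/2}` — so that
`Hess Φ ≥ z · Hess(6N - actionDensity)` at flat configurations and, by the monotonicity
`tr(AΣBΣ) ≥ tr(aΣbΣ)` (`A ≥ a ≥ 0`, `B ≥ b ≥ 0`), the leading `Φ–Φ` two-point coefficient is at least
`z²` times the two-gluon exchange of plaquette deficits. Intended inhabitant: the local part, in the
block field, of the conditional mean of the block-AVERAGED fine action density (Jensen gives the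
dominance clause); `Φ = z·(6N - actionDensity)` itself (`F` affine in the matrix entries, `D³F = 0`) shows the
class is non-trivially inhabited, while the triage's `z·x₀ - C·x₀^{3/2}` is NOT a member (not `C³` at flat
configurations — the regularity is deliberate: merely measurable members sandwiched between the two
clauses could flip the sign of the `Φ–Φ` covariance through oscillating cubic-order parts). -/
def IsPlaquetteLike (ρ : G →* Matrix (Fin N) (Fin N) ℂ) (z CΦ BΦ : ℝ) (R : ℕ)
    (Φ : LGConfig 4 G → ℝ) : Prop :=
  Measurable Φ ∧ IsZdGaugeInvariant Φ ∧ (∀ U, |Φ U| ≤ BΦ) ∧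
    ∃ (Pl : Finset (ZdPlaquette 4)) (F : (↥Pl → Matrix (Fin N) (Fin N) ℂ) → ℝ),
      (∀ p ∈ Pl, ∀ i : Fin 4, |p.1 i| ≤ (R : ℤ)) ∧
      (∀ U, Φ U = F (fun p => ρ (plaquetteHolonomyZd U p.1.1 p.1.2.1.1 p.1.2.1.2))) ∧
      ContDiff ℝ 3 F ∧ (∀ X, ‖iteratedFDeriv ℝ 3 F X‖ ≤ CΦ) ∧
      (∀ U, Φ U ≤ CΦ * ∑ p ∈ Pl, deficit ρ p U) ∧
      ∀ U, z * (6 * (N : ℝ) - actionDensity ρ U) -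
          CΦ * (∑ p ∈ Pl, deficit ρ p U) ^ (3 / 2 : ℝ) ≤ Φ U

end Class

/-! ## § Statements of the three stubs -/

/-- **Stub 1 (load-bearing, XL) — two-sided transport to fixed distance.**
For every compact simple `G`, faithful unitary `r` and `M ≥ 2` there are format data
`(cb, κ, C₀, Λ)`, class constants `(CΦ, BΦ)` and constants `(C', cβ, Cβ, Cfl, cfl)`, ALL UNIFORM IN
THE ULTRAVIOLET DEPTH `u` (= the squared running coupling `g*²` at the coarse scale; the quantifier
order `∃ data, ∀ u` is the card's "honest bet" that Bałaban's inductive format does not degrade along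
the flow — CMP 119 Thm 2: "`E₁` independent of `j, k, Ω, {Ω_j}, {Λ_j}, T`"), while the analyticity
radius `rad`, the small-field threshold `ε` and the term size `B₀` are PER INSTANCE, tied only by the
dimensionless format relations `B₀ ≤ Λ rad²` (Cauchy: stiffness of the terms `≲ Λ`) and
`𝓔.β·ε, 𝓔.β·rad² ≥ P` for any demanded `P` once `u ≤ u₀(P)` (Bałaban's domains have radius
`≍ g p₀(g)` and threshold `p₀(g)² → ∞`: card falsifier (2) is thereby defused — the skeleton does not
bet on `β`-independent domains), such that for every demanded `P`, every `u ∈ (0, u₀(P)]`, every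
`j₀` (fixed coarse separation `K' = M^{j₀}`), every coarse-volume floor
`Svol`, every slack `η > 0` and all `(B, m₀, L₀)` there are a depth `m ≥ max m₀ j₀` (block factor
`L' = M^{m-j₀}`), a torus `2L+1` with `L ≥ L₀ M^m` and a coupling `β* ≥ B` — intended: the
asymptotic-freedom placement at which the running coupling at scale `L'` is `u` (`≍ 2/u +
4 b₀ (m - j₀) log M` in tree units, beyond any `B` for `m` large; TRIAGE S1) — such that for EVERY
`β ≥ β*` the Wilson theory on the torus `2L+1` blocks, through a measurable block map `link` of block
size `L'` (intended inhabitant: the `(m-j₀)`-fold iterate of Bałaban's gauge-covariant one-step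
AVERAGING, tree `BalabanAveraging.link` — any torus side, ragged seam — with the exp/log block mean;
NOT the straight-line decimation `GaugeBlockAveraging.axial`, for which the coupling window below
is unreachable — TRIAGE S2), EXACTLY onto the Gibbs measure of a Bałaban-format effective action `𝓔`
on a coarse torus of side `Sc ≥ Svol` — push-forward identity `link_* μ_{β, 2L+1} = μ_𝓔` (Bałaban
CMP 119 (0.1) + Thm 1 for general compact `G ⊆ U(N)`: in print modulo the tree's collapsed format,
unvendored) — whose effective coupling is weak and pinned to the depth, `cβ/u ≤ 𝓔.β` for all
`β ≥ β*` and `𝓔.β ≤ Cβ/u` at `β = β*` (one/two-loop running; `z = ∏ⱼ(1 + O(gⱼ⁴))` bounded), together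
with a plaquette-like coarse observable `Φ` (normalisation `z ∈ [1/2, 2]`, support radius `R` with
`2R < K'` — TRIAGE r1-2/r1-3: the quasi-local tail beyond `K'/2` goes into the `e^{-cfl K'}` term)
such that for every integer separation `t ≥ 1` fitting in the half torus the crux's rescaled
correlator IS the coarse `Φ–Φ` covariance at the FIXED coarse separation `t K'` up to
`K'⁸ (C' u³ + Cfl u² e^{-cfl K'}) + η`.
Inside (line card § Stubs, the foreseen split): T1 density flow in format; T2 one-insertion LINEAR
transport of the block-averaged action density, `E[P̄₀ | V] = c - L'⁻⁴ Φ(V) + Rem`,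
`|Rem| ≤ C (u³ + L'⁻²) L'⁻⁴` on the `u`-small event, the ALL-`V` cap `|E[P̄₀ | V] - c| ≤ C L'⁻⁴`
(kinematic compactness screen; TRIAGE S3) and bad-event probability `≤ C u³` uniformly in the
volume; T3 conditional (fluctuation) covariance `≤ Cfl u² e^{-cfl K'} L'⁻⁸`, the massive fluctuation
field at scale `L'` — the `u²` here is what lets the assembly fix `K'` BEFORE `u`; T4 law of total
covariance (`η` absorbs the `L'⁻²` terms: the stub chooses `m`). Two-sidedness at all `t` and all
`β ≥ β*` discharges clause (iii) of the crux with the trivial coarse bound `|Cov_𝓔| ≤ 2 BΦ²` and NO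
reflection positivity (Disproof § ClauseThree, warning (1)). -/
def TwoSidedTransport : Prop :=
  ∀ (G : Type) [Group G] [TopologicalSpace G] [IsTopologicalGroup G] [CompactSpace G],
    IsCompactSimpleLieGroup G →
      letI : MeasurableSpace G := borel G
      haveI : BorelSpace G := ⟨rfl⟩
      ∀ (r : LatticeRep G) (M : ℕ), 2 ≤ M →
        ∃ (cb : ℕ) (_ : NeZero cb) (κ C₀ Λ CΦ BΦ : ℝ) (C' cβ Cβ Cfl cfl : ℝ),
          0 < κ ∧ 0 < cβ ∧ 0 < cfl ∧ 0 ≤ C' ∧ 0 ≤ Cfl ∧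
          ∀ (P : ℝ), ∃ u₀ : ℝ, 0 < u₀ ∧ ∀ (u : ℝ), 0 < u → u ≤ u₀ →
            ∀ (j₀ Svol : ℕ) (η : ℝ), 0 < η → ∀ (B : ℝ) (m₀ L₀ : ℕ),
            ∃ m : ℕ, m₀ ≤ m ∧ j₀ ≤ m ∧ ∃ L : ℕ, L₀ * M ^ m ≤ L ∧ ∃ βs : ℝ, B ≤ βs ∧
              ∀ β : ℝ, βs ≤ β →
                ∃ (Sc : ℕ) (_ : NeZero Sc), Svol ≤ Sc ∧
                ∃ (link : GaugeConfig 4 (2 * L + 1) G → GaugeConfig 4 Sc G), Measurable link ∧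
                ∃ (𝓔 : BalabanEffectiveAction 4 Sc G cb) (Φ : LGConfig 4 G → ℝ) (z B₀ rad ε : ℝ) (R : ℕ),
                  0 < rad ∧ 0 < ε ∧ B₀ ≤ Λ * rad ^ 2 ∧ 1 / 2 ≤ z ∧ z ≤ 2 ∧ 2 * R < M ^ j₀ ∧
                  𝓔.InFormat r.ρ (smallFieldDomain r.ρ cb rad ε) κ B₀ C₀ ∧
                  cβ / u ≤ 𝓔.β ∧ (β = βs → 𝓔.β ≤ Cβ / u) ∧ P ≤ 𝓔.β * ε ∧ P ≤ 𝓔.β * rad ^ 2 ∧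
                  Measure.map link (wilsonMeasure (d := 4) (L := 2 * L + 1) r.ρ β) =
                    𝓔.terms.perturbedMeasure r.ρ 𝓔.β ∧
                  IsPlaquetteLike r.ρ z CΦ BΦ R Φ ∧
                  ∀ t : ℕ, 1 ≤ t → t * M ^ m ≤ L →
                    |rescaledCorr r M m L β t -
                        ((M : ℝ) ^ j₀) ^ 8 * 𝓔.terms.connectedCorr r.ρ 𝓔.β Φ Φ (t * M ^ j₀)| ≤
                      ((M : ℝ) ^ j₀) ^ 8 * (C' * u ^ 3 + Cfl * u ^ 2 * Real.exp (-(cfl * (M : ℝ) ^ j₀))) + η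

/-- **Stub 2 (L) — the fixed-window lower bound for the PLAIN Wilson theory.**
For every compact simple `G` and faithful unitary `r` there are `c₁ = c₁(G, r) > 0` and a volume
factor `Cvol` such that for all class constants `(CΦ, BΦ)` and every separation `K' ≥ 1` there is a
threshold `β₀` (it may depend on `K'`: the assembly fixes `K'` first) beyond which EVERY plaquette-like
`Φ` of the class — any normalisation `z ∈ [1/2, 2]`, any support radius `R < K'/2` — on EVERY torus of
side `S ≥ Cvol·K'` has time-separation-`K'` connected Wilson correlation `≥ c₁ β⁻² K'⁻⁸`: the
two-gluon exchange of the origin deficits (`c₁ → ¼ · dim G · inf_{K' ≥ 1} K'⁸ ∑ (∂∂C_lat)²(K'e₀) > 0`),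
UNIFORM over the class by PSD monotonicity at quadratic order (`Hess Φ ≥ z Hess x₀`, all quadratic
cross terms `2 tr(AΣBΣ) ≥ 0`) and Cauchy–Schwarz on the `C³` remainders (relative
`O(CΦ K'^{12} β^{-1/2})`). A fixed-distance, finitely-many-scales, volume-uniform WEAK-coupling LOWER
bound (TRIAGE r1-2: "physically safe (`K' ≪ ξ(β)`), not in print for 4-d non-abelian `G`"; the
recommended common first stub of this line and `block-conditioned-covariance`); infrared-robust,
because a mixture of phases only ADDS the non-negative variance of the phase means to a `Φ–Φ`
covariance (the same remark as "torons on small tori correlate positively"). -/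
def FixedWindowLowerBound : Prop :=
  ∀ (G : Type) [Group G] [TopologicalSpace G] [IsTopologicalGroup G] [CompactSpace G],
    IsCompactSimpleLieGroup G →
      letI : MeasurableSpace G := borel G
      haveI : BorelSpace G := ⟨rfl⟩
      ∀ (r : LatticeRep G), ∃ c₁ : ℝ, 0 < c₁ ∧ ∃ Cvol : ℕ,
        ∀ (CΦ BΦ : ℝ) (K' : ℕ), 1 ≤ K' →
          ∃ β₀ : ℝ, ∀ (z : ℝ) (R : ℕ) (Φ : LGConfig 4 G → ℝ) (S : ℕ) [NeZero S] (β : ℝ),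
            1 / 2 ≤ z → z ≤ 2 → 2 * R < K' → IsPlaquetteLike r.ρ z CΦ BΦ R Φ →
              Cvol * K' ≤ S → β₀ ≤ β →
                c₁ / β ^ 2 ≤ (K' : ℝ) ^ 8 * latticeConnectedCorr r.ρ β S Φ Φ K'

/-- **Stub 3 (M) — robustness of the fixed window under Bałaban-format terms.**
For all uniform format data `(cb, κ > 0, C₀, Λ)`, class constants `(CΦ, BΦ)`, `K' ≥ 1` and every
relative accuracy `δ > 0` there are thresholds `P₀, β₁` such that every effective action
`𝓔 = β·A + ∑_X E_X` in format on domains of radius `rad` and threshold `ε` with term size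
`B₀ ≤ Λ rad²`, `β ≥ β₁`, `β ε ≥ P₀`, `β rad² ≥ P₀`, on every coarse torus of side `S > 2K'`, for
every plaquette-like `Φ` (`z ∈ [1/2,2]`, `R < K'/2`), has `Φ–Φ` connected correlation at separation
`K'` within `δ β⁻² K'⁻⁸·K'⁸` of the plain Wilson one at the same `β`: the terms are gauge invariant (no
invariant linear form on a simple `𝔤`: no tadpole) and analytic with weighted norm `≤ B₀` on the
complex `rad`-neighbourhoods `smallFieldDomain`, hence by Cauchy estimates their stiffness is
`≲ B₀/rad² ≤ Λ` against Wilson's `β` (relative `O(Λ/β)`), their higher vertices `B₀/rad^k` are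
relatively `O(Λ/(β rad²)) ≤ O(Λ/P₀)`, genuinely bilocal terms `E_X`, `X ∋ 0, K'e₀`, of size
`B₀ e^{-κK'}` move the covariance by `O(B₀ e^{-κK'} β⁻⁴)`, and configurations outside the `ε`-small
region (where only the floor `C₀` controls the terms) carry Wilson weight `e^{-c β ε} ≤ e^{-c P₀}`
(TRIAGE r1-1 §D, r1-3's adversarial-format probe: "killed only for `β² ≲ B₀ e^{-κK'} K'⁸`"). -/
def FormatRobustness : Prop :=
  ∀ (G : Type) [Group G] [TopologicalSpace G] [IsTopologicalGroup G] [CompactSpace G],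
    IsCompactSimpleLieGroup G →
      letI : MeasurableSpace G := borel G
      haveI : BorelSpace G := ⟨rfl⟩
      ∀ (r : LatticeRep G) (cb : ℕ) [NeZero cb] (κ C₀ Λ CΦ BΦ : ℝ) (K' : ℕ),
        0 < κ → 1 ≤ K' → ∀ δ : ℝ, 0 < δ →
          ∃ P₀ β₁ : ℝ, ∀ (B₀ rad ε z : ℝ) (R : ℕ) (Φ : LGConfig 4 G → ℝ) (S : ℕ) [NeZero S]
            (𝓔 : BalabanEffectiveAction 4 S G cb),
            0 < rad → 0 < ε → B₀ ≤ Λ * rad ^ 2 → 1 / 2 ≤ z → z ≤ 2 → 2 * R < K' → 2 * K' < S →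
              IsPlaquetteLike r.ρ z CΦ BΦ R Φ →
              𝓔.InFormat r.ρ (smallFieldDomain r.ρ cb rad ε) κ B₀ C₀ → β₁ ≤ 𝓔.β →
              P₀ ≤ 𝓔.β * ε → P₀ ≤ 𝓔.β * rad ^ 2 →
                |(K' : ℝ) ^ 8 * 𝓔.terms.connectedCorr r.ρ 𝓔.β Φ Φ K' -
                    (K' : ℝ) ^ 8 * latticeConnectedCorr r.ρ 𝓔.β S Φ Φ K'| ≤ δ / 𝓔.β ^ 2

/-! ## § Registered stubs

`stub_*` are the registered obligations (sorried). `Registered.stub_*` are the name-keyed `abbrev`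
aliases of their statements, taken as the hypotheses of `TunedSequenceExists_of` (the skeleton audit
admits a hypothesis whose head's last name component is a declared stub — same device as
`Summits/FinalStateConjecture/FinalStateConjecture/Cruxes/TameCensorship/Lines/necks-are-one-way-valves.lean`). -/

namespace Registered

/-- Alias of `TwoSidedTransport`, keyed by the registered stub name. -/
abbrev stub_transport : Prop := TwoSidedTransport
/-- Alias of `FixedWindowLowerBound`, keyed by the registered stub name. -/
abbrev stub_fixedWindowWilson : Prop := FixedWindowLowerBound
/-- Alias of `FormatRobustness`, keyed by the registered stub name. -/
abbrev stub_formatRobustness : Prop := FormatRobustness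

end Registered

/-- STUB 1 (HARDEST, XL — the lever): two-sided transport to fixed distance. -/
theorem stub_transport : TwoSidedTransport := by
  sorry

/-- STUB 2 (L): fixed-window lower bound for the plain Wilson theory, uniform over the class and the
volume. -/
theorem stub_fixedWindowWilson : FixedWindowLowerBound := by
  sorry

/-- STUB 3 (M): Bałaban-format terms perturb the fixed window by `O(β⁻³)`. -/
theorem stub_formatRobustness : FormatRobustness := by
  sorry

end Summit.QuantumFields.YangMills.Cruxes.TunedSequenceExists.TransportToFixedDistance
namespace Summit.QuantumFields.YangMills.Cruxes.TunedSequenceExists.TransportToFixedDistance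

/-! ## § Glue A — from the standing `Disproof.lean` of this crux

Copied verbatim from `Cruxes/TunedSequenceExists/Disproof.lean` (refuter-cdisprove-stmt-QuantumFields-10524,
gens 1–3; `Cruxes/` modules are not built, so that file cannot be imported): the crux body `Window`
and its definitional unfolding `tunedSequenceExists_iff`, re-indexing of schemes and DIAGONAL
EXTRACTION (`window_of_windowBdd` — § ClauseThree: clause (iii) costs exactly an a-priori bound on
the `N_t`). The freezing / β-continuity / IVT machinery (§ Freezing, § Glue there) has LANDED as the
importable `Theorems/TunedSequenceExists/Negative/{Freezing,Glue}.lean` and is imported, not copied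
(`Negative.Glue.exists_ge_corr_eq`). All sorry-free. -/

namespace Glue

section Shape

variable {G : Type} [Group G] [TopologicalSpace G] [IsTopologicalGroup G] [CompactSpace G]
  [MeasurableSpace G] [BorelSpace G]

/-- The body of the crux at fixed `(G, r, M)` (verbatim): a window `(0, θ₀)` of attainable tuned
limits. -/
def Window (r : LatticeRep G) (M : ℕ) : Prop :=
  ∃ θ₀ : ℝ, 0 < θ₀ ∧ ∀ θ : ℝ, 0 < θ → θ < θ₀ →
    ∃ (sch : SpeciesScheme (YMSpecies G)) (n : ℕ → ℕ),
      (∀ k, sch.a k = ((M : ℝ) ^ n k)⁻¹) ∧ Tendsto sch.β atTop atTop ∧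
      (∀ t : ℕ, 0 < t → ∃ c : ℝ, Tendsto (fun k => ((M : ℝ) ^ n k) ^ 8 *
          latticeConnectedCorr r.ρ (sch.β k) (sch.side k) r.curvature.F r.curvature.F
            (t * M ^ n k)) atTop (𝓝 c)) ∧
      Tendsto (fun k => ((M : ℝ) ^ n k) ^ 8 *
          latticeConnectedCorr r.ρ (sch.β k) (sch.side k) r.curvature.F r.curvature.F
            (M ^ n k)) atTop (𝓝 θ)

end Shape

/-- The crux is `∀ G simple, ∀ r, ∀ M ≥ 2, Window r M` (definitional unfolding). -/
theorem tunedSequenceExists_iff :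
    TunedSequenceExists ↔
      ∀ (G : Type) [Group G] [TopologicalSpace G] [IsTopologicalGroup G] [CompactSpace G],
        IsCompactSimpleLieGroup G → letI : MeasurableSpace G := borel G
        haveI : BorelSpace G := ⟨rfl⟩
        ∀ (r : LatticeRep G) (M : ℕ), 2 ≤ M → Window r M :=
  Iff.rfl


/-! ### § ClauseThree (subset) — re-indexing and diagonal extraction -/

section ClauseThree

variable {ι : Type}

/-- Re-indexing a scaling scheme along a strictly increasing map `φ : ℕ → ℕ` gives a scaling
scheme (`a ∘ φ → 0` and `(a L) ∘ φ → ∞` along the subsequence). -/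
def reindex (sch : SpeciesScheme ι) (φ : ℕ → ℕ) (hφ : StrictMono φ) : SpeciesScheme ι where
  a := sch.a ∘ φ
  a_pos k := sch.a_pos (φ k)
  tendsto_a := sch.tendsto_a.comp hφ.tendsto_atTop
  β := sch.β ∘ φ
  L := sch.L ∘ φ
  tendsto_L := sch.tendsto_L.comp hφ.tendsto_atTop
  c s := sch.c s ∘ φ
  m s := sch.m s ∘ φ

@[simp] theorem reindex_a (sch : SpeciesScheme ι) (φ : ℕ → ℕ) (hφ : StrictMono φ) (k : ℕ) :
    (reindex sch φ hφ).a k = sch.a (φ k) := rfl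

@[simp] theorem reindex_β (sch : SpeciesScheme ι) (φ : ℕ → ℕ) (hφ : StrictMono φ) (k : ℕ) :
    (reindex sch φ hφ).β k = sch.β (φ k) := rfl

@[simp] theorem reindex_L (sch : SpeciesScheme ι) (φ : ℕ → ℕ) (hφ : StrictMono φ) (k : ℕ) :
    (reindex sch φ hφ).L k = sch.L (φ k) := rfl

@[simp] theorem reindex_side (sch : SpeciesScheme ι) (φ : ℕ → ℕ) (hφ : StrictMono φ) (k : ℕ) :
    (reindex sch φ hφ).side k = sch.side (φ k) := rfl

variable {G : Type} [Group G] [TopologicalSpace G] [IsTopologicalGroup G] [CompactSpace G]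
  [MeasurableSpace G] [BorelSpace G]

/-- The crux body with clause (iii) WEAKENED to boundedness of every `N_t` along the witness. -/
def WindowBdd (r : LatticeRep G) (M : ℕ) : Prop :=
  ∃ θ₀ : ℝ, 0 < θ₀ ∧ ∀ θ : ℝ, 0 < θ → θ < θ₀ →
    ∃ (sch : SpeciesScheme (YMSpecies G)) (n : ℕ → ℕ),
      (∀ k, sch.a k = ((M : ℝ) ^ n k)⁻¹) ∧ Tendsto sch.β atTop atTop ∧
      (∀ t : ℕ, 0 < t → ∃ C : ℝ, ∀ k, |((M : ℝ) ^ n k) ^ 8 *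
          latticeConnectedCorr r.ρ (sch.β k) (sch.side k) r.curvature.F r.curvature.F
            (t * M ^ n k)| ≤ C) ∧
      Tendsto (fun k => ((M : ℝ) ^ n k) ^ 8 *
          latticeConnectedCorr r.ρ (sch.β k) (sch.side k) r.curvature.F r.curvature.F
            (M ^ n k)) atTop (𝓝 θ)

/-- **Diagonal extraction.** A witness with bounded `N_t` (all `t ≥ 1`) has a re-indexing along
which every `N_t` converges; the re-indexed scheme is again an `M`-adic scheme with `β → ∞` and the
same tuned limit. -/
theorem window_of_windowBdd (r : LatticeRep G) (M : ℕ) (h : WindowBdd r M) : Window r M := by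
  obtain ⟨θ₀, hθ₀, h⟩ := h
  refine ⟨θ₀, hθ₀, fun θ hθ hθ' => ?_⟩
  obtain ⟨sch, n, hshape, hβ, hbdd, hlim⟩ := h θ hθ hθ'
  -- the family of rescaled correlators, indexed by `t' = t - 1`
  set u : ℕ → ℕ → ℝ := fun k t' => ((M : ℝ) ^ n k) ^ 8 *
    latticeConnectedCorr r.ρ (sch.β k) (sch.side k) r.curvature.F r.curvature.F
      ((t' + 1) * M ^ n k) with hu
  choose C hC using fun t' : ℕ => hbdd (t' + 1) (Nat.succ_pos t')
  set K : Set (ℕ → ℝ) := Set.pi Set.univ fun t' => Set.Icc (-C t') (C t') with hK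
  have hKc : IsCompact K := isCompact_univ_pi fun t' => isCompact_Icc
  have huK : ∀ k, u k ∈ K := fun k => by
    simp only [hK, Set.mem_pi, Set.mem_univ, true_implies, Set.mem_Icc]
    intro t'
    exact abs_le.1 (hC t' k)
  obtain ⟨lim, -, φ, hφ, hconv⟩ := hKc.tendsto_subseq huK
  refine ⟨reindex sch φ hφ, n ∘ φ, fun k => hshape (φ k), hβ.comp hφ.tendsto_atTop, ?_, ?_⟩
  · intro t ht
    obtain ⟨t', rfl⟩ := Nat.exists_eq_succ_of_ne_zero ht.ne'
    refine ⟨lim t', ?_⟩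
    have h1 : Tendsto (fun j => u (φ j) t') atTop (𝓝 (lim t')) := tendsto_pi_nhds.1 hconv t'
    refine h1.congr fun j => ?_
    simp only [hu, Function.comp_apply, reindex_β, reindex_side, Nat.succ_eq_add_one]
  · exact hlim.comp hφ.tendsto_atTop

omit [TopologicalSpace G] [IsTopologicalGroup G] [CompactSpace G] [BorelSpace G] in
/-- An eventually bounded real sequence is bounded. -/
theorem exists_bound_of_eventually {u : ℕ → ℝ} {C : ℝ} (h : ∀ᶠ k in atTop, |u k| ≤ C) :
    ∃ C' : ℝ, ∀ k, |u k| ≤ C' := by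
  obtain ⟨K, hK⟩ := eventually_atTop.1 h
  refine ⟨max C (∑ j ∈ Finset.range K, |u j|), fun k => ?_⟩
  rcases lt_or_ge k K with hk | hk
  · exact le_max_of_le_right
      (Finset.single_le_sum (fun j _ => abs_nonneg (u j)) (Finset.mem_range.2 hk))
  · exact le_max_of_le_left (hK k hk)

end ClauseThree

end Glue

end Summit.QuantumFields.YangMills.Cruxes.TunedSequenceExists.TransportToFixedDistance
namespace Summit.QuantumFields.YangMills.Cruxes.TunedSequenceExists.TransportToFixedDistance

namespace Glue

/-! ## § Glue B (new, proved) — from the three stubs to the crux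

1. `abs_connectedCorr_le_of_map`: the TRIVIAL coarse-side bound `|Cov_𝓔(A, B)| ≤ 2 C_A C_B` once the
   coarse Gibbs measure is the push-forward of a Wilson (probability) measure — all that the a-priori
   bound for clause (iii) consumes (no decay, no reflection positivity, infrared-robust).
2. `err_le`, `window_arith`: the window-placement arithmetic.
3. `lowerBoundApriori_of_stubs`: choose `K' = M^{j₀}` with `2R < K'` and
   `Cfl K'^8 e^{-cfl K'} ≤ c₁/(8 Cβ'²)` (possible BEFORE the depth `u` is fixed because the fluctuation
   error carries `u²` — the one quantitative feature of the transport stub the assembly leans on), then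
   the thresholds `β₀(K')`, `β₁(K')`, then the depth `u` below every threshold, then `η`.
4. `window_of_lowerBoundApriori`: IVT tuning at each stage (Glue A) + the a-priori bound along the
   constructed scheme ⇒ `WindowBdd` ⇒ `Window` (diagonal extraction, Glue A). -/

section CoarseBound

variable {G : Type} [Group G] [TopologicalSpace G] [IsTopologicalGroup G] [CompactSpace G]
  [MeasurableSpace G] [BorelSpace G]

/-- Elementary: `|x - y w| ≤ 2ab` from `|x| ≤ ab`, `|y| ≤ a`, `|w| ≤ b`, `0 ≤ a`. -/
theorem abs_sub_mul_le {x y w a b : ℝ} (hx : |x| ≤ a * b) (hy : |y| ≤ a) (hw : |w| ≤ b)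
    (ha : 0 ≤ a) : |x - y * w| ≤ 2 * (a * b) := by
  calc |x - y * w| ≤ |x| + |y * w| := abs_sub _ _
    _ ≤ a * b + a * b := by
        rw [abs_mul]
        exact add_le_add hx (mul_le_mul hy hw (abs_nonneg _) ha)
    _ = 2 * (a * b) := by ring

/-- **The trivial coarse-side bound.** If the Gibbs measure of the effective action `𝓔` on the
coarse torus is the push-forward of a Wilson measure along a measurable block map, then it is a
probability measure and the connected correlation of bounded observables is at most `2 C_A C_B` —
uniformly in everything. -/
theorem abs_connectedCorr_le_of_map {N : ℕ} (ρ : G →* Matrix (Fin N) (Fin N) ℂ) (hρ : Continuous ρ)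
    {Sf Sc : ℕ} [NeZero Sf] [NeZero Sc] (β : ℝ) {link : GaugeConfig 4 Sf G → GaugeConfig 4 Sc G}
    (hlink : Measurable link) {cb : ℕ} (𝓔 : BalabanEffectiveAction 4 Sc G cb)
    (hpush : Measure.map link (wilsonMeasure (d := 4) (L := Sf) ρ β) =
      𝓔.terms.perturbedMeasure ρ 𝓔.β)
    {A B : LGConfig 4 G → ℝ} {CA CB : ℝ} (hA : ∀ U, |A U| ≤ CA) (hB : ∀ U, |B U| ≤ CB) (n : ℕ) :
    |𝓔.terms.connectedCorr ρ 𝓔.β A B n| ≤ 2 * (CA * CB) := by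
  haveI : IsProbabilityMeasure (wilsonMeasure (d := 4) (L := Sf) ρ β) :=
    isProbabilityMeasure_wilsonMeasure (d := 4) (L := Sf) ρ hρ β
  haveI : IsProbabilityMeasure (𝓔.terms.perturbedMeasure ρ 𝓔.β) := by
    rw [← hpush]
    exact Measure.isProbabilityMeasure_map hlink.aemeasurable
  have hCA : 0 ≤ CA := (abs_nonneg _).trans (hA fun _ => 1)
  have bound : ∀ (f : GaugeConfig 4 Sc G → ℝ) (C : ℝ), (∀ U, |f U| ≤ C) →
      |∫ U, f U ∂(𝓔.terms.perturbedMeasure ρ 𝓔.β)| ≤ C := fun f C hf => by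
    calc |∫ U, f U ∂(𝓔.terms.perturbedMeasure ρ 𝓔.β)|
        ≤ ∫ U, |f U| ∂(𝓔.terms.perturbedMeasure ρ 𝓔.β) := abs_integral_le_integral_abs
      _ ≤ ∫ _U, C ∂(𝓔.terms.perturbedMeasure ρ 𝓔.β) := by
          refine integral_mono_of_nonneg (ae_of_all _ fun U => abs_nonneg _)
            (integrable_const C) (ae_of_all _ fun U => hf U)
      _ = C := by simp
  have h1 := bound (fun U => A (torusLift Sc U) *
      B (configShift (-Pi.single 0 (n : ℤ)) (torusLift Sc U))) (CA * CB) fun U => by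
    rw [abs_mul]; exact mul_le_mul (hA _) (hB _) (abs_nonneg _) hCA
  have h2 := bound (fun U => A (torusLift Sc U)) CA fun U => hA _
  have h3 := bound (fun U => B (torusLift Sc U)) CB fun U => hB _
  simp only [QuasiLocalGaugePerturbation.connectedCorr, QuasiLocalGaugePerturbation.expectation]
  exact abs_sub_mul_le h1 h2 h3 hCA

end CoarseBound

section Arithmetic

/-- Error budget: `P (C' u³ + Cfl u² e) + A u² ≤ 3 A u²` once `C'p P u ≤ A` (`C' ≤ C'p`) and
`Cflp P e ≤ A` (`Cfl ≤ Cflp`). -/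
theorem err_le {P C' C'p Cfl Cflp u e A : ℝ} (hP : 0 ≤ P) (hu : 0 ≤ u) (he : 0 ≤ e)
    (hC' : C' ≤ C'p) (hCfl : Cfl ≤ Cflp) (h1 : C'p * P * u ≤ A) (h2 : Cflp * P * e ≤ A) :
    P * (C' * u ^ 3 + Cfl * u ^ 2 * e) + A * u ^ 2 ≤ 3 * (A * u ^ 2) := by
  have hu2 : 0 ≤ u ^ 2 := by positivity
  have hu3 : 0 ≤ u ^ 3 := by positivity
  have t1 : P * (C' * u ^ 3) ≤ A * u ^ 2 := by
    calc P * (C' * u ^ 3) ≤ P * (C'p * u ^ 3) := by gcongr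
      _ = (C'p * P * u) * u ^ 2 := by ring
      _ ≤ A * u ^ 2 := mul_le_mul_of_nonneg_right h1 hu2
  have t2 : P * (Cfl * u ^ 2 * e) ≤ A * u ^ 2 := by
    calc P * (Cfl * u ^ 2 * e) ≤ P * (Cflp * u ^ 2 * e) := by gcongr
      _ = (Cflp * P * e) * u ^ 2 := by ring
      _ ≤ A * u ^ 2 := mul_le_mul_of_nonneg_right h2 hu2
  nlinarith [t1, t2]

/-- The window arithmetic: fixed-window lower bound `c₁/b² ≤ W`, format robustness
`|E8 - W| ≤ (c₁/4)/b²`, the coupling ceiling `b ≤ Cβ'/u` and the transport error `|N₁ - E8| ≤ 3 A u²`,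
`A = c₁/(8 Cβ'²)`, give `A u² ≤ N₁` (with room: `N₁ ≥ 3 A u²`). -/
theorem window_arith {N₁ E8 W b c₁ Cβ' u A Err : ℝ}
    (hc₁ : 0 < c₁) (hb : 0 < b) (hu : 0 < u) (hCβ' : 0 < Cβ')
    (hW : c₁ / b ^ 2 ≤ W) (hR : |E8 - W| ≤ (c₁ / 4) / b ^ 2) (hbhi : b ≤ Cβ' / u)
    (hN : |N₁ - E8| ≤ Err) (hErr : Err ≤ 3 * (A * u ^ 2)) (hA : A = c₁ / (8 * Cβ' ^ 2)) :
    A * u ^ 2 ≤ N₁ := by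
  have hb2 : 0 < b ^ 2 := by positivity
  -- robustness
  have hE8 : (3 * c₁ / 4) / b ^ 2 ≤ E8 := by
    have h1 := (abs_le.1 hR).1
    have : c₁ / b ^ 2 - (c₁ / 4) / b ^ 2 = (3 * c₁ / 4) / b ^ 2 := by ring
    linarith
  -- the ceiling: `1/b² ≥ u²/Cβ'²`
  have hbu : b * u ≤ Cβ' := by rwa [le_div_iff₀ hu] at hbhi
  have hbu' : (b * u) ^ 2 ≤ Cβ' ^ 2 := by
    have h0 : 0 ≤ b * u := by positivity
    exact pow_le_pow_left₀ h0 hbu 2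
  have h4 : (3 * c₁ / 4) * (u ^ 2 / Cβ' ^ 2) ≤ (3 * c₁ / 4) / b ^ 2 := by
    have hC2 : 0 < Cβ' ^ 2 := by positivity
    rw [mul_div_assoc', div_le_div_iff₀ hC2 hb2]
    have : 3 * c₁ / 4 * u ^ 2 * b ^ 2 = 3 * c₁ / 4 * (b * u) ^ 2 := by ring
    rw [this]
    exact mul_le_mul_of_nonneg_left hbu' (by positivity)
  have h5 : (3 * c₁ / 4) * (u ^ 2 / Cβ' ^ 2) = 6 * (A * u ^ 2) := by
    rw [hA]
    field_simp
    ring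
  have hN' : E8 - Err ≤ N₁ := by
    have := (abs_le.1 hN).1
    linarith
  have hApos : 0 ≤ A * u ^ 2 := by rw [hA]; positivity
  linarith

end Arithmetic

section Assembly

variable {G : Type} [Group G] [TopologicalSpace G] [IsTopologicalGroup G] [CompactSpace G]
  [MeasurableSpace G] [BorelSpace G]

/-- **The finite-volume correlator window lower bound WITH the a-priori bound at the same lattice
data** (the two outputs of the transport line): beyond every coupling `B`, at arbitrarily fine
`M`-adic depth `m ≥ m₀` and on arbitrarily large tori `2L+1`, `L ≥ L₀ M^m`, some `β* ≥ B` has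
`N_1(β*) ≥ θ₀`, and `|N_t(β)| ≤ Cap` for every `β ≥ β*` and every `t ≥ 1` fitting in the half torus.
Strengthens Disproof § Glue `CorrelatorWindowLowerBound` by the a-priori clause, which replaces
§ ClauseThree's `AprioriBound` (all schemes) by a bound along the witness actually built. -/
def LowerBoundApriori (r : LatticeRep G) (M : ℕ) : Prop :=
  ∃ θ₀ : ℝ, 0 < θ₀ ∧ ∃ Cap : ℝ, ∀ (B : ℝ) (m₀ L₀ : ℕ), ∃ m : ℕ, m₀ ≤ m ∧ ∃ L : ℕ, L₀ * M ^ m ≤ L ∧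
    ∃ βs : ℝ, B ≤ βs ∧ θ₀ ≤ rescaledCorr r M m L βs 1 ∧
      ∀ β : ℝ, βs ≤ β → ∀ t : ℕ, 1 ≤ t → t * M ^ m ≤ L → |rescaledCorr r M m L β t| ≤ Cap

/-- **Lower bound + a-priori bound ⇒ the crux body** (`M ≥ 2`): at stage `k` take the lattice data
beyond `(B, m₀, L₀) = (k, k, k+1)`, tune EXACTLY to `θ` above `β*_k` by the intermediate value
theorem (β-continuity + freezing, Glue A), assemble the `M`-adic scheme `a_k = M^{-m_k}`,
`β_k ≥ β*_k ≥ k`, `L_k ≥ (k+1) M^{m_k}`; every `N_t`, `t ≥ 1`, is bounded by `Cap` from stage `k ≥ t`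
on, so the witness satisfies `WindowBdd`, and diagonal extraction (`window_of_windowBdd`) gives
`Window`. No reflection positivity, no `β = 0` endpoint. -/
theorem window_of_lowerBoundApriori (r : LatticeRep G) {M : ℕ} (hM : 2 ≤ M)
    (h : LowerBoundApriori r M) : Window r M := by
  obtain ⟨θ₀, hθ₀, Cap, h⟩ := h
  refine window_of_windowBdd r M ⟨θ₀, hθ₀, fun θ hθ hθθ₀ => ?_⟩
  choose m hm L hL βs hβs hcorr hap using fun k : ℕ => h (k : ℝ) k (k + 1)
  have hcorr' : ∀ k, θ₀ ≤ ((M : ℝ) ^ m k) ^ 8 *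
      latticeConnectedCorr r.ρ (βs k) (2 * L k + 1) r.curvature.F r.curvature.F (M ^ m k) := by
    intro k
    have := hcorr k
    simpa only [rescaledCorr, one_mul] using this
  choose β hββs hβeq using fun k : ℕ => exists_ge_corr_eq r M (m k) (L k) hθ hθθ₀ (hcorr' k)
  have hM1 : (1 : ℝ) < M := by exact_mod_cast hM
  have hm_top : Tendsto m atTop atTop := tendsto_atTop_mono hm tendsto_id
  have hpow_top : Tendsto (fun k => (M : ℝ) ^ m k) atTop atTop :=
    (tendsto_pow_atTop_atTop_of_one_lt hM1).comp hm_top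
  have hL' : ∀ k, k * M ^ m k ≤ L k := fun k =>
    le_trans (Nat.mul_le_mul_right _ (Nat.le_succ k)) (hL k)
  let sch : SpeciesScheme (YMSpecies G) :=
    { a := fun k => ((M : ℝ) ^ m k)⁻¹
      a_pos := fun k => by positivity
      tendsto_a := tendsto_inv_atTop_zero.comp hpow_top
      β := β
      L := L
      tendsto_L := by
        refine tendsto_atTop_mono (fun k => ?_) tendsto_natCast_atTop_atTop
        have hLk : (k : ℝ) * (M : ℝ) ^ m k ≤ L k := by exact_mod_cast hL' k
        have hp : (0 : ℝ) < (M : ℝ) ^ m k := by positivity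
        show (k : ℝ) ≤ ((M : ℝ) ^ m k)⁻¹ * (L k : ℝ)
        rw [inv_mul_eq_div, le_div_iff₀ hp]
        exact hLk
      c := fun _ _ => 0
      m := fun _ _ => 0 }
  refine ⟨sch, m, fun k => rfl, ?_, ?_, ?_⟩
  · exact tendsto_atTop_mono (fun k => (hβs k).trans (hββs k)) tendsto_natCast_atTop_atTop
  · intro t ht
    refine exists_bound_of_eventually (C := Cap) ?_
    filter_upwards [eventually_ge_atTop t] with k hk
    have htL : t * M ^ m k ≤ L k := le_trans (Nat.mul_le_mul_right _ hk) (hL' k)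
    exact hap k (β k) (hββs k) t ht htL
  · refine tendsto_const_nhds.congr fun k => ?_
    exact (hβeq k).symm

/-- **The three stubs give the lower bound with the a-priori bound**, for every compact simple `G`,
faithful unitary `r` and `M ≥ 2` — the window-placement assembly of the card
(`θ₀ = c₁ u²/(8 Cβ'²)`, `Cβ' = max Cβ 1`). -/
theorem lowerBoundApriori_of_stubs (hT : TwoSidedTransport) (hW : FixedWindowLowerBound)
    (hR : FormatRobustness) (G : Type) [Group G] [TopologicalSpace G] [IsTopologicalGroup G]
    [CompactSpace G] (hG : IsCompactSimpleLieGroup G) :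
    letI : MeasurableSpace G := borel G
    haveI : BorelSpace G := ⟨rfl⟩
    ∀ (r : LatticeRep G) (M : ℕ), 2 ≤ M → LowerBoundApriori r M := by
  letI : MeasurableSpace G := borel G
  haveI : BorelSpace G := ⟨rfl⟩
  intro r M hM
  obtain ⟨cb, instcb, κ, C₀, Λ, CΦ, BΦ, C', cβ, Cβ, Cfl, cfl, hκ, hcβ, hcfl, hC', hCfl, HT⟩ :=
    hT G hG r M hM
  haveI : NeZero cb := instcb
  obtain ⟨c₁, hc₁, Cvol, HW⟩ := hW G hG r
  -- positive envelopes of the constants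
  have hCβ'pos : 0 < max Cβ 1 := lt_of_lt_of_le one_pos (le_max_right _ _)
  have hC'p : 0 < max C' 1 := lt_of_lt_of_le one_pos (le_max_right _ _)
  have hCflp : 0 < max Cfl 1 := lt_of_lt_of_le one_pos (le_max_right _ _)
  -- the budget unit `A = c₁/(8 Cβ'²)`
  set A : ℝ := c₁ / (8 * (max Cβ 1) ^ 2) with hAdef
  have hApos : 0 < A := by positivity
  have hM1 : (1 : ℝ) < M := by exact_mod_cast hM
  have hMpos : (0 : ℝ) < M := by positivity
  -- (a) the fixed coarse separation `K' = M^{j₀}`: `Cflp K'^8 e^{-cfl K'} ≤ A`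
  have hev2 : ∀ᶠ j : ℕ in atTop,
      max Cfl 1 * ((M : ℝ) ^ j) ^ 8 * Real.exp (-(cfl * (M : ℝ) ^ j)) ≤ A := by
    have h1 : Tendsto (fun x : ℝ => x ^ 8 * Real.exp (-x)) atTop (𝓝 0) :=
      Real.tendsto_pow_mul_exp_neg_atTop_nhds_zero 8
    have h2 : Tendsto (fun j : ℕ => cfl * (M : ℝ) ^ j) atTop atTop :=
      (tendsto_pow_atTop_atTop_of_one_lt hM1).const_mul_atTop hcfl
    have hδ : 0 < A * cfl ^ 8 / max Cfl 1 := by positivity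
    filter_upwards [(h1.comp h2).eventually (gt_mem_nhds hδ)] with j hj
    have hj' : (cfl * (M : ℝ) ^ j) ^ 8 * Real.exp (-(cfl * (M : ℝ) ^ j)) < A * cfl ^ 8 / max Cfl 1 := hj
    have hrew : max Cfl 1 * ((M : ℝ) ^ j) ^ 8 * Real.exp (-(cfl * (M : ℝ) ^ j)) =
        (max Cfl 1 / cfl ^ 8) * ((cfl * (M : ℝ) ^ j) ^ 8 * Real.exp (-(cfl * (M : ℝ) ^ j))) := by
      rw [mul_pow]
      field_simp
    rw [hrew]
    have hq : 0 < max Cfl 1 / cfl ^ 8 := by positivity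
    calc (max Cfl 1 / cfl ^ 8) * ((cfl * (M : ℝ) ^ j) ^ 8 * Real.exp (-(cfl * (M : ℝ) ^ j)))
        ≤ (max Cfl 1 / cfl ^ 8) * (A * cfl ^ 8 / max Cfl 1) :=
          mul_le_mul_of_nonneg_left hj'.le hq.le
      _ = A := by field_simp
  obtain ⟨j₀, hj₀e⟩ := hev2.exists
  have hK'1 : 1 ≤ M ^ j₀ := Nat.one_le_pow _ _ (by omega)
  have hKc : ((M ^ j₀ : ℕ) : ℝ) = (M : ℝ) ^ j₀ := by push_cast; rfl
  have hPpos : (0 : ℝ) < ((M : ℝ) ^ j₀) ^ 8 := by positivity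
  -- (b) the fixed-window threshold and (c) the robustness threshold at this `K'`
  obtain ⟨β₀, Hβ₀⟩ := HW CΦ BΦ (M ^ j₀) hK'1
  obtain ⟨P₀, β₁, Hβ₁⟩ :=
    hR G hG r cb κ C₀ Λ CΦ BΦ (M ^ j₀) hκ hK'1 (c₁ / 4) (by positivity)
  have hβ₀p : 0 < max β₀ 1 := lt_of_lt_of_le one_pos (le_max_right _ _)
  have hβ₁p : 0 < max β₁ 1 := lt_of_lt_of_le one_pos (le_max_right _ _)
  -- (d) the ultraviolet depth `u = g*²`: small enough for the transport's format guarantees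
  -- `P₀ ≤ 𝓔.β ε`, `P₀ ≤ 𝓔.β rad²` (`u ≤ u₀(P₀)`) and below every threshold
  obtain ⟨u₀, hu₀, HT₀⟩ := HT P₀
  set U₄ : ℝ := A / (max C' 1 * ((M : ℝ) ^ j₀) ^ 8) with hU₄def
  have hU₄ : 0 < U₄ := by positivity
  set u : ℝ := min u₀ (min (cβ / max β₀ 1) (min (cβ / max β₁ 1) U₄)) with hudef
  have hu_pos : 0 < u := by positivity
  have hu_u₀ : u ≤ u₀ := min_le_left _ _
  have hu_β₀ : u ≤ cβ / max β₀ 1 := (min_le_right _ _).trans (min_le_left _ _)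
  have hu_β₁ : u ≤ cβ / max β₁ 1 :=
    (min_le_right _ _).trans ((min_le_right _ _).trans (min_le_left _ _))
  have hu_U : u ≤ U₄ :=
    (min_le_right _ _).trans ((min_le_right _ _).trans (min_le_right _ _))
  -- the coupling floor `cβ/u` clears a threshold `T` as soon as `u ≤ cβ/T`
  have clear : ∀ {T b : ℝ}, 0 < T → u ≤ cβ / T → cβ / u ≤ b → T ≤ b := by
    intro T b hT' huT hb
    have h1 : cβ / (cβ / T) ≤ cβ / u := div_le_div_of_nonneg_left hcβ.le hu_pos huT
    have h2 : cβ / (cβ / T) = T := by field_simp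
    linarith
  -- (e) the slack `η` and the coarse-volume floor
  have hη : 0 < A * u ^ 2 := by positivity
  have HT' := HT₀ u hu_pos hu_u₀ j₀ (max (Cvol * M ^ j₀) (2 * M ^ j₀ + 1)) (A * u ^ 2) hη
  -- the error term of the transport stub at this depth, and the a-priori cap
  set Err : ℝ := ((M : ℝ) ^ j₀) ^ 8 * (C' * u ^ 3 + Cfl * u ^ 2 * Real.exp (-(cfl * (M : ℝ) ^ j₀))) +
    A * u ^ 2 with hErrdef
  have hErr : Err ≤ 3 * (A * u ^ 2) := by
    refine err_le hPpos.le hu_pos.le (Real.exp_pos _).le (le_max_left C' 1) (le_max_left Cfl 1) ?_ ?_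
    · -- `C'p P u ≤ A` from `u ≤ U₄ = A/(C'p P)`
      have hden : 0 < max C' 1 * ((M : ℝ) ^ j₀) ^ 8 := by positivity
      have := (le_div_iff₀ hden).1 hu_U
      linarith
    · simpa [mul_assoc] using hj₀e
  refine ⟨A * u ^ 2, hη, ((M : ℝ) ^ j₀) ^ 8 * (2 * (BΦ * BΦ)) + Err, fun B m₀ L₀ => ?_⟩
  obtain ⟨m, hm₀, -, L, hL, βs, hBβs, Hβ⟩ := HT' B m₀ (max L₀ 1)
  have hL' : L₀ * M ^ m ≤ L := le_trans (Nat.mul_le_mul_right _ (le_max_left _ _)) hL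
  have hML : 1 * M ^ m ≤ L := le_trans (Nat.mul_le_mul_right _ (le_max_right L₀ 1)) hL
  refine ⟨m, hm₀, L, hL', βs, hBβs, ?_, ?_⟩
  · -- the lower bound at `β*`
    obtain ⟨Sc, instSc, hSvol, link, hlink, 𝓔, Φ, z, B₀, rad, ε, R, hrad, hε, hB₀, hz1, hz2, hRK, hfmt,
      hlo, hhi, hPε, hPr, hpush, hcls, Hid⟩ := Hβ βs le_rfl
    haveI : NeZero Sc := instSc
    have hid1 := Hid 1 le_rfl hML
    rw [one_mul] at hid1
    have hb_pos : 0 < 𝓔.β := lt_of_lt_of_le (div_pos hcβ hu_pos) hlo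
    have hb_β₀ : β₀ ≤ 𝓔.β := (le_max_left _ _).trans (clear hβ₀p hu_β₀ hlo)
    have hb_β₁ : β₁ ≤ 𝓔.β := (le_max_left _ _).trans (clear hβ₁p hu_β₁ hlo)
    have hb_hi : 𝓔.β ≤ max Cβ 1 / u :=
      (hhi rfl).trans (div_le_div_of_nonneg_right (le_max_left _ _) hu_pos.le)
    have hCvol : Cvol * M ^ j₀ ≤ Sc := (le_max_left _ _).trans hSvol
    have h2K : 2 * M ^ j₀ < Sc := (le_max_right _ _).trans hSvol
    have hW1 := Hβ₀ z R Φ Sc 𝓔.β hz1 hz2 hRK hcls hCvol hb_β₀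
    have hR1 := Hβ₁ B₀ rad ε z R Φ Sc 𝓔 hrad hε hB₀ hz1 hz2 hRK h2K hcls hfmt hb_β₁ hPε hPr
    rw [hKc] at hW1 hR1
    exact window_arith hc₁ hb_pos hu_pos hCβ'pos hW1 hR1 hb_hi hid1 hErr hAdef
  · -- the a-priori bound at every `β ≥ β*`
    intro β hβ t ht htL
    obtain ⟨Sc, instSc, hSvol, link, hlink, 𝓔, Φ, z, B₀, rad, ε, R, hrad, hε, hB₀, hz1, hz2, hRK, hfmt,
      hlo, hhi, hPε, hPr, hpush, hcls, Hid⟩ := Hβ β hβ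
    haveI : NeZero Sc := instSc
    have hidt := Hid t ht htL
    have hΦ : ∀ U, |Φ U| ≤ BΦ := hcls.2.2.1
    have hcoarse := abs_connectedCorr_le_of_map r.ρ r.continuous β hlink 𝓔 hpush hΦ hΦ (t * M ^ j₀)
    have hE8 : |((M : ℝ) ^ j₀) ^ 8 * 𝓔.terms.connectedCorr r.ρ 𝓔.β Φ Φ (t * M ^ j₀)| ≤
        ((M : ℝ) ^ j₀) ^ 8 * (2 * (BΦ * BΦ)) := by
      rw [abs_mul, abs_of_pos hPpos]
      exact mul_le_mul_of_nonneg_left hcoarse hPpos.le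
    have htri := abs_sub_abs_le_abs_sub (rescaledCorr r M m L β t)
      (((M : ℝ) ^ j₀) ^ 8 * 𝓔.terms.connectedCorr r.ρ 𝓔.β Φ Φ (t * M ^ j₀))
    linarith

end Assembly

end Glue

/-! ## § The skeleton theorem -/

/-- **`TunedSequenceExists` from the three stubs** (kernel-checked composition; the only `sorry`s of
this file sit inside `stub_transport`, `stub_fixedWindowWilson`, `stub_formatRobustness`): unfold the
crux to `∀ G simple, ∀ r, ∀ M ≥ 2, Window r M` (`Glue.tunedSequenceExists_iff`, `Iff.rfl`), get the
lower bound with the a-priori bound from the stubs (`Glue.lowerBoundApriori_of_stubs`: window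
placement), and turn it into a tuned witness (`Glue.window_of_lowerBoundApriori`: IVT + freezing +
diagonal extraction). -/
theorem TunedSequenceExists_of :
    Registered.stub_transport → Registered.stub_fixedWindowWilson →
      Registered.stub_formatRobustness → TunedSequenceExists := by
  intro hT hW hR
  refine Glue.tunedSequenceExists_iff.2 fun G _ _ _ _ hG => ?_
  letI : MeasurableSpace G := borel G
  haveI : BorelSpace G := ⟨rfl⟩
  intro r M hM
  exact Glue.window_of_lowerBoundApriori r hM (Glue.lowerBoundApriori_of_stubs hT hW hR G hG r M hM)

end Summit.QuantumFields.YangMills.Cruxes.TunedSequenceExists.TransportToFixedDistance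
end
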